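import Mathlib
import Literature.Analysis.FluidPDE.VectorCalculus
import Summits.NavierStokesRegularity.NavierStokesRegularity.Theorems.ThreadingFluxErtelTowerStagnationJetSlopes
import Summits.NavierStokesRegularity.NavierStokesRegularity.Theorems.ThreadingFluxErtelTowerEulerTower
import HarnessLib

/-!
# Crux `PoloidalLiouville` (stmt-NavierStokesRegularity-1222, W1), crux idea «radial-jerk-tower» (ns-idea-15 g7):
# JET RIGIDITY AT A STAGNATION CENTRE — the inviscid shadow about a stagnation point of a REAL-ANALYTIC steady drift

Support file (`--supports stmt-NavierStokesRegularity-1222`, helper).  Experiment cell `ns-wall-extremal`, width hand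
ns-wall-eng-5 g9, item (ε) E6b (second half of the «analytic nonlinear upgrade of (ε) at stagnation points» named by g8's
handoff, `HOME/ARM-B/shadow-eng5g8/README.md`, SUCCESSOR ITEM 1; first half = `…ErtelTowerStagnationJetSlopes`, E6a).  0 kit.
Theorem-only; nothing of the sketch `Cruxes/PoloidalLiouville/ErtelTowerSketch.lean` is restated or closed.

E6a shows, for a SMOOTH steady drift with a stagnation point `x₀` whose velocity gradient `A = Du(x₀)` commutes with no rotation
generator, that the discriminant `D(x) = ⟪x − x₀, ∇θ₁(x) × ∇θ₂(x)⟫` of `inviscidKinematicRigidity` is not flat at `x₀`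
(`disc_not_eventuallyEq_zero_of_stagnation`).  For a REAL-ANALYTIC drift this decides the inviscid shadow on the whole domain:

* `analyticOnNhd_radialJerk_steady`, `analyticOnNhd_disc_steady` — the steady radial-jerk tower and the discriminant of a
  real-analytic drift are real-analytic on `U` (recursion `θ_{k+1} = ⟪u, ∇θ_k⟫` in `ContDiffOn ℝ ω`);
* `subset_closure_ne_zero_of_analyticOnNhd` — identity theorem (Mathlib `AnalyticOnNhd.eqOn_zero_of_preconnected_of_eventuallyEq_zero`):
  a real-analytic function on a preconnected open set, not flat at one point, is non-zero on a dense subset; hence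
  ★ `dense_disc_ne_zero_of_stagnation` / `dense_disc_ne_zero_of_nonStagnation` — the rank-two set `{D ≠ 0}` is dense in `U`;
* ★★★ `inviscidJetRigidity_stagnation` — **for a real-analytic steady drift `u` on a preconnected open `U ∋ x₀` with `u x₀ = 0`
  whose gradient `Du(x₀)` commutes with no rotation generator `z ↦ w × z` (`w ≠ 0`), every smooth field frozen into `u` on `I × U`
  (`I` open: `∂ₜB + DB[u] − Du[B] = 0`) and tangent to the spheres about `x₀` VANISHES IDENTICALLY on `I × U`**
  (`inviscidKinematicRigidity` BY NAME on the dense set `{D ≠ 0}`);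
* ★★ `inviscidJetRigidity_nonStagnation_analytic` — E5's ball statement (`v × (Av + 2A†v) ≠ 0`, `inviscidJetRigidity_nonStagnation`)
  globalised to all of `I × U` for analytic drifts (`gradient_disc_centre`: `∇D(x₀) ≠ 0`);
* ★★★ `inviscidJetRigidity_analytic` — THE 1-JET TEST at every centre of a real-analytic steady drift: `v × (Av + 2A†v) ≠ 0`, or
  `v = 0` and `A` non-axisymmetric, ⇒ the inviscid shadow about `x₀` is EMPTY on `I × U`;
* STEADY EULER (the frozen field is the vorticity, `vorticity_frozen` / `euler_curl_eq_zero_of_rankTwo_dense` of `…ErtelTowerEulerTower`):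
  ★★★ `steadyEuler_curl_eq_zero_of_stagnation` — **a steady incompressible Euler flow `(v, p)` on a preconnected open `U`
  (`v` real-analytic, `p` smooth), whose vortex lines are tangent to the spheres about a STAGNATION POINT `x₀ ∈ U` at which `Dv(x₀)`
  commutes with no rotation generator, is IRROTATIONAL on `U`**; ★★ `steadyEuler_curl_eq_zero_of_jet` — the same about a
  non-stagnation centre with `v(x₀) × ∇(‖v‖² − p)(x₀) ≠ 0` (`jetVector_steadyEuler`: E5's jet vector is `∇(‖v‖² − p)` on Euler pairs).

SHARPNESS (cited, not restated): at a stagnation centre the test is exhaustive on the 1-jet — for axisymmetric `A` the analytic drift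
`A(x − x₀)` (stagnation point `x₀`, gradient `A`) carries the frozen sphere-tangent field `w × (x − x₀) ≢ 0` on every `I × U`
(E3 ★★★ `inviscidLinearFlow_dichotomy`); about a non-stagnation centre only the LINEAR part of the affine discriminant is
jet-universal (E5, E4c `inviscidAffineFlow_dichotomy`).

HONEST FRAME: LOCAL-TO-GLOBAL statements about the INVISCID shadow (frozen-field equation) in a prescribed real-analytic steady drift,
and about unthreaded real-analytic steady EULER flows (inviscid; analyticity is a hypothesis, not a theorem, for Euler);
information-grade helper under ⟨1222⟩; says nothing about NS; `PoloidalLiouville` (1222) / `UnthreadedRigidity` (27585) OPEN;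
NS regularity NOT proved.
-/

-- the summit and its single problem share the name (D-0017 nested layout)
set_option linter.dupNamespace false

noncomputable section

namespace Summit.NavierStokesRegularity.NavierStokesRegularity.Theorems.PoloidalLiouville.ErtelTower

open Set Function Filter Metric Topology
open scoped Topology RealInnerProductSpace InnerProductSpace ContDiff
open Literature.Analysis.FluidPDE
open Summit.NavierStokesRegularity.NavierStokesRegularity.Theorems.PoloidalLiouville.HorizonTower (E3)

/-! ### The steady tower of an analytic drift is analytic -/

section Analytic

variable {u : E3 → E3} {U : Set E3} {x₀ : E3}

/-- The steady tower of a `C^ω` drift is `C^ω` on `U` (the recursion `θ_{k+1} = ⟪u, ∇θ_k⟫`, `radialJerk_succ_steady`). -/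
theorem contDiffOn_omega_radialJerk_steady (hU : IsOpen U) (hu : ContDiffOn ℝ ω u U) (x₀ : E3) :
    ∀ k : ℕ, ContDiffOn ℝ ω (radialJerk (fun _ : ℝ => u) x₀ k 0) U
  | 0 => by
      have h : radialJerk (fun _ : ℝ => u) x₀ 0 0 = fun x : E3 => ‖x - x₀‖ ^ 2 / 2 := rfl
      rw [h]
      exact (((contDiff_norm_sq ℝ).comp (contDiff_id.sub contDiff_const)).div_const _).contDiffOn
  | k + 1 => by
      have ih := contDiffOn_omega_radialJerk_steady hU hu x₀ k
      have hgrad : ContDiffOn ℝ ω (gradient (radialJerk (fun _ : ℝ => u) x₀ k 0)) U :=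
        (InnerProductSpace.toDual ℝ E3).symm.toContinuousLinearEquiv.contDiff.comp_contDiffOn
          (ih.fderiv_of_isOpen hU le_rfl)
      have h : radialJerk (fun _ : ℝ => u) x₀ (k + 1) 0
          = fun x : E3 => ⟪u x, gradient (radialJerk (fun _ : ℝ => u) x₀ k 0) x⟫ :=
        funext (radialJerk_succ_steady u x₀ k)
      rw [h]
      exact hu.inner ℝ hgrad

/-- ★ **The steady radial-jerk tower of a real-analytic drift is real-analytic** (every level, on `U`). -/
theorem analyticOnNhd_radialJerk_steady (hU : IsOpen U) (hu : AnalyticOnNhd ℝ u U) (x₀ : E3) (k : ℕ) :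
    AnalyticOnNhd ℝ (radialJerk (fun _ : ℝ => u) x₀ k 0) U := fun _ hx =>
  ((contDiffOn_omega_radialJerk_steady hU hu.contDiffOn_of_completeSpace x₀ k).contDiffAt (hU.mem_nhds hx)).analyticAt

/-- The tower gradients of a `C^ω` drift are `C^ω`. -/
theorem contDiffOn_omega_gradient_radialJerk_steady (hU : IsOpen U) (hu : ContDiffOn ℝ ω u U) (x₀ : E3) (k : ℕ) :
    ContDiffOn ℝ ω (gradient (radialJerk (fun _ : ℝ => u) x₀ k 0)) U :=
  (InnerProductSpace.toDual ℝ E3).symm.toContinuousLinearEquiv.contDiff.comp_contDiffOn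
    ((contDiffOn_omega_radialJerk_steady hU hu x₀ k).fderiv_of_isOpen hU le_rfl)

/-- ★ **The discriminant `D(x) = ⟪x − x₀, ∇θ₁(x) × ∇θ₂(x)⟫ of a real-analytic steady drift is real-analytic on `U`.** -/
theorem analyticOnNhd_disc_steady (hU : IsOpen U) (hu : AnalyticOnNhd ℝ u U) (x₀ : E3) :
    AnalyticOnNhd ℝ (fun x : E3 => ⟪x - x₀, cross (gradient (radialJerk (fun _ : ℝ => u) x₀ 1 0) x)
        (gradient (radialJerk (fun _ : ℝ => u) x₀ 2 0) x)⟫) U := by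
  have hg : ∀ k, ContDiffOn ℝ ω (gradient (radialJerk (fun _ : ℝ => u) x₀ k 0)) U :=
    contDiffOn_omega_gradient_radialJerk_steady hU hu.contDiffOn_of_completeSpace x₀
  have hH : ContDiffOn ℝ ω (fun x : E3 => cross (gradient (radialJerk (fun _ : ℝ => u) x₀ 1 0) x)
      (gradient (radialJerk (fun _ : ℝ => u) x₀ 2 0) x)) U := by
    have h : ContDiffOn ℝ ω (fun x : E3 => crossCLM (gradient (radialJerk (fun _ : ℝ => u) x₀ 1 0) x)
        (gradient (radialJerk (fun _ : ℝ => u) x₀ 2 0) x)) U :=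
      crossCLM.isBoundedBilinearMap.contDiff.comp_contDiffOn ((hg 1).prodMk (hg 2))
    simpa only [crossCLM_apply] using h
  have hD : ContDiffOn ℝ ω (fun x : E3 => ⟪x - x₀, cross (gradient (radialJerk (fun _ : ℝ => u) x₀ 1 0) x)
      (gradient (radialJerk (fun _ : ℝ => u) x₀ 2 0) x)⟫) U :=
    ((contDiff_id.sub contDiff_const).contDiffOn).inner ℝ hH
  exact fun _ hx => (hD.contDiffAt (hU.mem_nhds hx)).analyticAt

end Analytic

/-! ### Identity theorem: a non-flat analytic function is non-zero on a dense set -/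

section Identity

/-- A function that is NOT zero on a dense subset of the open `V` vanishes near some point of `V`. -/
theorem eventuallyEq_zero_of_not_mem_closure {f : E3 → ℝ} {V : Set E3} (hV : IsOpen V) {y : E3} (hy : y ∈ V)
    (h : y ∉ closure {x | x ∈ V ∧ f x ≠ 0}) : f =ᶠ[𝓝 y] fun _ => 0 := by
  filter_upwards [isClosed_closure.isOpen_compl.mem_nhds h, hV.mem_nhds hy] with w hw hwV
  by_contra hne
  exact hw (subset_closure ⟨hwV, hne⟩)

/-- ★ **Density from the identity theorem.**  A real-analytic function on a preconnected open `V` which is not identically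
zero near one point `x₀ ∈ V` is non-zero on a dense subset of `V`
(Mathlib `AnalyticOnNhd.eqOn_zero_of_preconnected_of_eventuallyEq_zero`). -/
theorem subset_closure_ne_zero_of_analyticOnNhd {f : E3 → ℝ} {V : Set E3} (hV : IsOpen V) (hVc : IsPreconnected V)
    (hf : AnalyticOnNhd ℝ f V) {x₀ : E3} (hx₀ : x₀ ∈ V) (h0 : ¬ f =ᶠ[𝓝 x₀] fun _ => 0) :
    V ⊆ closure {x | x ∈ V ∧ f x ≠ 0} := by
  intro y hy
  by_contra hcl
  have hev : f =ᶠ[𝓝 y] 0 := eventuallyEq_zero_of_not_mem_closure hV hy hcl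
  have hzero : EqOn f 0 V := hf.eqOn_zero_of_preconnected_of_eventuallyEq_zero hVc hy hev
  exact h0 (by filter_upwards [hV.mem_nhds hx₀] with w hw using hzero hw)

end Identity

/-! ### Density of the rank-two set for analytic drifts -/

section Density

variable {u : E3 → E3} {U : Set E3} {x₀ : E3}

/-- ★ **At a non-axisymmetric stagnation centre of a real-analytic drift on a preconnected open `U`, the rank-two set
`{x ∈ U | ⟪x − x₀, ∇θ₁ × ∇θ₂⟫ ≠ 0}` is dense in `U`** (at every time slot of the steady tower):
`disc_not_eventuallyEq_zero_of_stagnation` (E6a) + `analyticOnNhd_disc_steady` + the identity theorem. -/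
theorem dense_disc_ne_zero_of_stagnation (hU : IsOpen U) (hUc : IsPreconnected U) (hx₀ : x₀ ∈ U) (hu : AnalyticOnNhd ℝ u U)
    (hstag : u x₀ = 0) (hA : ¬ ∃ w : E3, w ≠ 0 ∧ ∀ z : E3, fderiv ℝ u x₀ (cross w z) = cross w (fderiv ℝ u x₀ z)) (t : ℝ) :
    U ⊆ closure {x | x ∈ U ∧ ⟪x - x₀, cross (gradient (radialJerk (fun _ : ℝ => u) x₀ 1 t) x)
      (gradient (radialJerk (fun _ : ℝ => u) x₀ 2 t) x)⟫ ≠ 0} := by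
  have hflat := disc_not_eventuallyEq_zero_of_stagnation hU hu.contDiffOn_of_completeSpace hx₀ hstag hA
  rw [radialJerk_steady u x₀ 1 t 0, radialJerk_steady u x₀ 2 t 0]
  exact subset_closure_ne_zero_of_analyticOnNhd hU hUc (analyticOnNhd_disc_steady hU hu x₀) hx₀ hflat

/-- ★ The same about a NON-stagnation centre under E5's jet condition `v × (A v + 2A† v) ≠ 0` (`gradient_disc_centre`:
`∇D(x₀) ≠ 0`, so `D` is not flat at `x₀`). -/
theorem dense_disc_ne_zero_of_nonStagnation (hU : IsOpen U) (hUc : IsPreconnected U) (hx₀ : x₀ ∈ U)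
    (hu : AnalyticOnNhd ℝ u U)
    (hjet : cross (u x₀) (fderiv ℝ u x₀ (u x₀) + (2 : ℝ) • (ContinuousLinearMap.adjoint (fderiv ℝ u x₀)) (u x₀)) ≠ 0)
    (t : ℝ) :
    U ⊆ closure {x | x ∈ U ∧ ⟪x - x₀, cross (gradient (radialJerk (fun _ : ℝ => u) x₀ 1 t) x)
      (gradient (radialJerk (fun _ : ℝ => u) x₀ 2 t) x)⟫ ≠ 0} := by
  have hu' : ContDiffOn ℝ (⊤ : ℕ∞) u U := hu.contDiffOn_of_completeSpace
  have hflat : ¬ ((fun x : E3 => ⟪x - x₀, cross (gradient (radialJerk (fun _ : ℝ => u) x₀ 1 0) x)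
      (gradient (radialJerk (fun _ : ℝ => u) x₀ 2 0) x)⟫) =ᶠ[𝓝 x₀] fun _ => 0) := by
    intro hD
    have hgrad : gradient (fun x : E3 => ⟪x - x₀, cross (gradient (radialJerk (fun _ : ℝ => u) x₀ 1 0) x)
        (gradient (radialJerk (fun _ : ℝ => u) x₀ 2 0) x)⟫) x₀ = 0 := by
      rw [(gradient_congr_nhds hD).eq_of_nhds, gradient, fderiv_const_apply, map_zero]
    rw [gradient_disc_centre hU hu' hx₀] at hgrad
    exact hjet hgrad
  rw [radialJerk_steady u x₀ 1 t 0, radialJerk_steady u x₀ 2 t 0]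
  exact subset_closure_ne_zero_of_analyticOnNhd hU hUc (analyticOnNhd_disc_steady hU hu x₀) hx₀ hflat

end Density

/-! ### Jet rigidity for analytic drifts -/

section JetRigidity

/-- ★★★ **JET RIGIDITY AT A STAGNATION CENTRE (real-analytic steady drift).**  Let `u` be real-analytic on a preconnected open
`U ∋ x₀` with `u x₀ = 0`, and suppose the velocity gradient `A = Du(x₀)` commutes with NO rotation generator `z ↦ w × z`, `w ≠ 0`
(the linear flow `A z` is not axisymmetric about any axis through the centre).  Then EVERY smooth field `B` frozen into `u` on
`I × U` (`I` open: `∂ₜB + DB[u] − Du[B] = 0`) and tangent to the spheres about `x₀` VANISHES IDENTICALLY on `I × U`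
(`dense_disc_ne_zero_of_stagnation` + `inviscidKinematicRigidity` BY NAME).
SHARP ON THE 1-JET: for axisymmetric `A` the analytic drift `A(x − x₀)` carries the frozen sphere-tangent field `w × (x − x₀) ≢ 0`
(`inviscidLinearFlow_dichotomy`, E3). -/
theorem inviscidJetRigidity_stagnation (u : E3 → E3) (x₀ : E3) (U : Set E3) (hU : IsOpen U) (hUc : IsPreconnected U)
    (hx₀ : x₀ ∈ U) (hu : AnalyticOnNhd ℝ u U) (hstag : u x₀ = 0)
    (hA : ¬ ∃ w : E3, w ≠ 0 ∧ ∀ z : E3, fderiv ℝ u x₀ (cross w z) = cross w (fderiv ℝ u x₀ z))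
    (B : ℝ → E3 → E3) (I : Set ℝ) (hI : IsOpen I) (hB : ContDiffOn ℝ (⊤ : ℕ∞) (uncurry B) (I ×ˢ U))
    (hfrozen : ∀ t ∈ I, ∀ x ∈ U, deriv (fun s => B s x) t + fderiv ℝ (B t) x (u x) - fderiv ℝ u x (B t x) = 0)
    (htan : ∀ t ∈ I, ∀ x ∈ U, ⟪B t x, x - x₀⟫ = 0) :
    ∀ t ∈ I, ∀ x ∈ U, B t x = 0 :=
  inviscidKinematicRigidity (fun _ : ℝ => u) B x₀ I U hI hU
    (hu.contDiffOn_of_completeSpace.comp contDiffOn_snd fun _ hp => hp.2) hB hfrozen htan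
    fun t _ => dense_disc_ne_zero_of_stagnation hU hUc hx₀ hu hstag hA t

/-- ★★ **JET RIGIDITY ABOUT A NON-STAGNATION CENTRE, GLOBAL FORM FOR ANALYTIC DRIFTS.**  Let `u` be real-analytic on a
preconnected open `U ∋ x₀`, `v = u(x₀)`, `A = Du(x₀)`, with `v × (A v + 2A† v) ≠ 0` (the jet condition of
`inviscidJetRigidity_nonStagnation`, E5).  Then every smooth field frozen into `u` on `I × U` and tangent to the spheres about
`x₀` vanishes on ALL of `I × U` — not only on a ball about `x₀`. -/
theorem inviscidJetRigidity_nonStagnation_analytic (u : E3 → E3) (x₀ : E3) (U : Set E3) (hU : IsOpen U)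
    (hUc : IsPreconnected U) (hx₀ : x₀ ∈ U) (hu : AnalyticOnNhd ℝ u U)
    (hjet : cross (u x₀) (fderiv ℝ u x₀ (u x₀) + (2 : ℝ) • (ContinuousLinearMap.adjoint (fderiv ℝ u x₀)) (u x₀)) ≠ 0)
    (B : ℝ → E3 → E3) (I : Set ℝ) (hI : IsOpen I) (hB : ContDiffOn ℝ (⊤ : ℕ∞) (uncurry B) (I ×ˢ U))
    (hfrozen : ∀ t ∈ I, ∀ x ∈ U, deriv (fun s => B s x) t + fderiv ℝ (B t) x (u x) - fderiv ℝ u x (B t x) = 0)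
    (htan : ∀ t ∈ I, ∀ x ∈ U, ⟪B t x, x - x₀⟫ = 0) :
    ∀ t ∈ I, ∀ x ∈ U, B t x = 0 :=
  inviscidKinematicRigidity (fun _ : ℝ => u) B x₀ I U hI hU
    (hu.contDiffOn_of_completeSpace.comp contDiffOn_snd fun _ hp => hp.2) hB hfrozen htan
    fun t _ => dense_disc_ne_zero_of_nonStagnation hU hUc hx₀ hu hjet t

/-- ★★★ **THE 1-JET TEST (real-analytic steady drifts, every centre).**  Let `u` be real-analytic on a preconnected open `U ∋ x₀`,
`v = u(x₀)`, `A = Du(x₀)`.  If EITHER `v × (A v + 2A† v) ≠ 0`, OR `v = 0` and `A` commutes with no rotation generator, then the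
inviscid shadow about `x₀` is EMPTY on `I × U`: every smooth field frozen into `u` and tangent to the spheres about `x₀` vanishes. -/
theorem inviscidJetRigidity_analytic (u : E3 → E3) (x₀ : E3) (U : Set E3) (hU : IsOpen U) (hUc : IsPreconnected U)
    (hx₀ : x₀ ∈ U) (hu : AnalyticOnNhd ℝ u U)
    (hjet : cross (u x₀) (fderiv ℝ u x₀ (u x₀) + (2 : ℝ) • (ContinuousLinearMap.adjoint (fderiv ℝ u x₀)) (u x₀)) ≠ 0 ∨
      (u x₀ = 0 ∧ ¬ ∃ w : E3, w ≠ 0 ∧ ∀ z : E3, fderiv ℝ u x₀ (cross w z) = cross w (fderiv ℝ u x₀ z)))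
    (B : ℝ → E3 → E3) (I : Set ℝ) (hI : IsOpen I) (hB : ContDiffOn ℝ (⊤ : ℕ∞) (uncurry B) (I ×ˢ U))
    (hfrozen : ∀ t ∈ I, ∀ x ∈ U, deriv (fun s => B s x) t + fderiv ℝ (B t) x (u x) - fderiv ℝ u x (B t x) = 0)
    (htan : ∀ t ∈ I, ∀ x ∈ U, ⟪B t x, x - x₀⟫ = 0) :
    ∀ t ∈ I, ∀ x ∈ U, B t x = 0 := by
  rcases hjet with hjet | ⟨hstag, hA⟩
  · exact inviscidJetRigidity_nonStagnation_analytic u x₀ U hU hUc hx₀ hu hjet B I hI hB hfrozen htan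
  · exact inviscidJetRigidity_stagnation u x₀ U hU hUc hx₀ hu hstag hA B I hI hB hfrozen htan

end JetRigidity

/-! ### Steady Euler flows: the frozen field is the vorticity -/

section SteadyEuler

variable {v : E3 → E3} {p : E3 → ℝ} {U : Set E3} {x₀ : E3}

/-- A steady real-analytic Euler pair `(v, p)` (`p` smooth) on the open `U`, read as a time-independent solution on `univ × U`,
meets the hypotheses of `euler_curl_eq_zero_of_rankTwo_dense`; with a dense rank-two set it is irrotational. -/
theorem steadyEuler_curl_eq_zero_of_dense (hU : IsOpen U) (hv : AnalyticOnNhd ℝ v U) (hp : ContDiffOn ℝ (⊤ : ℕ∞) p U)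
    (heuler : ∀ x ∈ U, fderiv ℝ v x (v x) + gradient p x = 0)
    (hdiv : ∀ x ∈ U, Literature.Analysis.FluidPDE.VectorCalculus.divergence v x = 0)
    (hunthr : ∀ x ∈ U, ⟪curl v x, x - x₀⟫ = 0)
    (hdense : ∀ t : ℝ, U ⊆ closure {x | x ∈ U ∧ ⟪x - x₀, cross (gradient (radialJerk (fun _ : ℝ => v) x₀ 1 t) x)
      (gradient (radialJerk (fun _ : ℝ => v) x₀ 2 t) x)⟫ ≠ 0}) :
    ∀ x ∈ U, curl v x = 0 := by
  have hv' : ContDiffOn ℝ (⊤ : ℕ∞) (uncurry fun (_ : ℝ) (z : E3) => v z) ((univ : Set ℝ) ×ˢ U) :=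
    hv.contDiffOn_of_completeSpace.comp contDiffOn_snd fun q hq => hq.2
  have hp' : ContDiffOn ℝ (⊤ : ℕ∞) (uncurry fun (_ : ℝ) (z : E3) => p z) ((univ : Set ℝ) ×ˢ U) :=
    hp.comp contDiffOn_snd fun q hq => hq.2
  have heuler' : ∀ t ∈ (univ : Set ℝ), ∀ x ∈ U,
      deriv (fun _ : ℝ => v x) t + fderiv ℝ v x (v x) + gradient p x = 0 := by
    intro t _ x hx
    rw [deriv_const, zero_add]
    exact heuler x hx
  intro x hx
  exact euler_curl_eq_zero_of_rankTwo_dense (v := fun _ : ℝ => v) (p := fun _ : ℝ => p) isOpen_univ hU hv' hp' heuler'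
    (fun _ _ y hy => hdiv y hy) (fun _ _ y hy => hunthr y hy) (fun t _ => hdense t) 0 (mem_univ _) x hx

/-- ★★★ **STAGNATION-POINT RIGIDITY OF UNTHREADED ANALYTIC STEADY EULER FLOWS.**  Let `(v, p)` be a steady incompressible Euler
solution on a preconnected open `U` (`v` real-analytic, `p` smooth, `Dv[v] + ∇p = 0`, `div v = 0`) whose vortex lines are tangent
to the spheres about `x₀ ∈ U` (`⟪curl v, x − x₀⟫ = 0` on `U`).  If `x₀` is a STAGNATION POINT (`v x₀ = 0`) whose velocity gradient
`Dv(x₀)` commutes with no rotation generator, then `v` is IRROTATIONAL on `U`.  (The vorticity is frozen into `v`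
— `vorticity_frozen` / `euler_curl_eq_zero_of_rankTwo_dense` — and `dense_disc_ne_zero_of_stagnation`.) -/
theorem steadyEuler_curl_eq_zero_of_stagnation (v : E3 → E3) (p : E3 → ℝ) (x₀ : E3) (U : Set E3) (hU : IsOpen U)
    (hUc : IsPreconnected U) (hx₀ : x₀ ∈ U) (hv : AnalyticOnNhd ℝ v U) (hp : ContDiffOn ℝ (⊤ : ℕ∞) p U)
    (heuler : ∀ x ∈ U, fderiv ℝ v x (v x) + gradient p x = 0)
    (hdiv : ∀ x ∈ U, Literature.Analysis.FluidPDE.VectorCalculus.divergence v x = 0)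
    (hunthr : ∀ x ∈ U, ⟪curl v x, x - x₀⟫ = 0) (hstag : v x₀ = 0)
    (hA : ¬ ∃ w : E3, w ≠ 0 ∧ ∀ z : E3, fderiv ℝ v x₀ (cross w z) = cross w (fderiv ℝ v x₀ z)) :
    ∀ x ∈ U, curl v x = 0 :=
  steadyEuler_curl_eq_zero_of_dense hU hv hp heuler hdiv hunthr (dense_disc_ne_zero_of_stagnation hU hUc hx₀ hv hstag hA)

/-- For a steady Euler pair the jet vector of E5 at `x₀` is `∇(‖v‖² − p)(x₀)`:  `A v + 2A† v = −∇p + ∇‖v‖²`, `v = v(x₀)`,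
`A = Dv(x₀)` (`Dv·v = −∇p`, `∇‖v‖² = 2(Dv)†v` — `gradient_inner_self_drift`, E5). -/
theorem jetVector_steadyEuler (hU : IsOpen U) (hv : AnalyticOnNhd ℝ v U) (hp : ContDiffOn ℝ (⊤ : ℕ∞) p U)
    (heuler : ∀ x ∈ U, fderiv ℝ v x (v x) + gradient p x = 0) (hx₀ : x₀ ∈ U) :
    fderiv ℝ v x₀ (v x₀) + (2 : ℝ) • (ContinuousLinearMap.adjoint (fderiv ℝ v x₀)) (v x₀)
      = gradient (fun y : E3 => ⟪v y, v y⟫ - p y) x₀ := by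
  have hvd : DifferentiableAt ℝ v x₀ := (hv x₀ hx₀).differentiableAt
  have hpd : DifferentiableAt ℝ p x₀ := (hp.differentiableOn (by simp)).differentiableAt (hU.mem_nhds hx₀)
  have h1 : DifferentiableAt ℝ (fun y : E3 => ⟪v y, v y⟫) x₀ := hvd.inner ℝ hvd
  have hsub : (fun y : E3 => ⟪v y, v y⟫ - p y) = (fun y : E3 => ⟪v y, v y⟫) - p := rfl
  rw [hsub, gradient, fderiv_sub h1 hpd, map_sub]
  change _ = gradient (fun y : E3 => ⟪v y, v y⟫) x₀ - gradient p x₀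
  rw [gradient_inner_self_drift hvd, eq_sub_iff_add_eq, add_right_comm, heuler x₀ hx₀, zero_add]

/-- ★★ **JET RIGIDITY OF UNTHREADED ANALYTIC STEADY EULER FLOWS ABOUT A NON-STAGNATION CENTRE.**  With `(v, p)` as in
`steadyEuler_curl_eq_zero_of_stagnation` but, instead of stagnation, `v(x₀) × ∇(‖v‖² − p)(x₀) ≠ 0`: `v` is irrotational on `U`
(`jetVector_steadyEuler` + `dense_disc_ne_zero_of_nonStagnation`). -/
theorem steadyEuler_curl_eq_zero_of_jet (v : E3 → E3) (p : E3 → ℝ) (x₀ : E3) (U : Set E3) (hU : IsOpen U)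
    (hUc : IsPreconnected U) (hx₀ : x₀ ∈ U) (hv : AnalyticOnNhd ℝ v U) (hp : ContDiffOn ℝ (⊤ : ℕ∞) p U)
    (heuler : ∀ x ∈ U, fderiv ℝ v x (v x) + gradient p x = 0)
    (hdiv : ∀ x ∈ U, Literature.Analysis.FluidPDE.VectorCalculus.divergence v x = 0)
    (hunthr : ∀ x ∈ U, ⟪curl v x, x - x₀⟫ = 0)
    (hjet : cross (v x₀) (gradient (fun y : E3 => ⟪v y, v y⟫ - p y) x₀) ≠ 0) :
    ∀ x ∈ U, curl v x = 0 := by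
  rw [← jetVector_steadyEuler hU hv hp heuler hx₀] at hjet
  exact steadyEuler_curl_eq_zero_of_dense hU hv hp heuler hdiv hunthr
    (dense_disc_ne_zero_of_nonStagnation hU hUc hx₀ hv hjet)

end SteadyEuler

end Summit.NavierStokesRegularity.NavierStokesRegularity.Theorems.PoloidalLiouville.ErtelTower

end
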